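import Literature.AlgebraicGeometry.Motives.TateAbelianFiniteStepsProofs
import HarnessLib

/-!
# The Tate module of a biproduct of abelian varieties

`Literature.AlgebraicGeometry.Motives.TateAbelianFiniteSteps` and its descendants
(`TateAbelianFiniteLattice`, `TateAbelianLatticeOfFinitenessProofs`,
`FaltingsECOfAbelianVarietyLatticeProofs`, `FaltingsECSubspacesHomOfAbelianVarietyProofs`)
consume products of abelian varieties over a field `K` as explicit bicone data: a
`b : BinaryBicone A A'` with `b.fst ≫ b.inl + b.snd ≫ b.inr = 𝟙 b.pt` (available for every pair
by `AbelianVariety.exists_binaryBicone_total_holds`, `TateAbelianFiniteStepsProofs`), and Tate's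
lattice lemma for the vertex `b.pt = A ⊞ A'` (`tateSubspaceRealization_of_finite`,
`tateSubspaceRealization_of_finitenessI`) asks for `T_ℓ(b.pt)` free of finite rank over `ℤ_ℓ`
(the named facts `AbelianVariety.module_free_tateModule`, `AbelianVariety.module_finite_tateModule`
of `AVGaloisModule`; Mumford, *Abelian Varieties*, §19, p. 171), so far supplied from
`#P[n](K̄) = n^{2 dim P}` (`natCard_torsionPoints_of_isAlgClosed`, Mumford §6).

This file proves that the Tate module of a biproduct is the product of the Tate modules:
`(T_ℓ fst, T_ℓ snd) : T_ℓ(b.pt) ≃ₗ[ℤ_ℓ] T_ℓ A × T_ℓ A'` with inverse `T_ℓ inl ∘ pr₁ + T_ℓ inr ∘ pr₂`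
— `T_ℓ` is an additive functor (Mumford §19, p. 176; in the tree `tateModuleMap_add`,
`tateModuleMap_comp`, `tateModuleMap_id`, `tateModuleMap_zero` of `AVIsogenyTate`), so it carries
the biproduct `A ⊞ A'` to the biproduct `T_ℓ A ⊕ T_ℓ A'` of `ℤ_ℓ`-modules — whence `T_ℓ(b.pt)` is
finitely generated, resp. free, as soon as `T_ℓ A` and `T_ℓ A'` are. Consumer:
`Literature.AlgebraicGeometry.Motives.FaltingsECOfFinitenessIProofs`, where `A, A'` are bridged to
elliptic curves, whose Tate modules are free of rank `2` by theorems of the tree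
(`WeierstrassCurve.module_free_tateModule_holds`, `module_finite_tateModule_holds`), so that the
hypothesis `natCard_torsionPoints_of_isAlgClosed` disappears from the elliptic-curve reductions.

## Contents (all proved; no definitions, no named facts)

* `AbelianVariety.tateModuleMap_bicone_total`, `…_inl_fst`, `…_inl_snd`, `…_inr_fst`,
  `…_inr_snd`: the biproduct identities for `T_ℓ fst, T_ℓ snd, T_ℓ inl, T_ℓ inr`.
* `AbelianVariety.nonempty_tateModule_linearEquiv_prod`: `T_ℓ(b.pt) ≃ₗ[ℤ_ℓ] T_ℓ A × T_ℓ A'`.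
* `AbelianVariety.module_finite_tateModule_pt`, `AbelianVariety.module_free_tateModule_pt`: the
  named facts `module_finite_tateModule b.pt ℓ`, `module_free_tateModule b.pt ℓ` from the same
  facts for `A` and `A'`.

## References

* [MumfordAV1970] D. Mumford, *Abelian Varieties* (1970), §19, pp. 171, 176 (`T_ℓ` as a functor
  on homomorphisms, `T_ℓ A ≅ ℤ_ℓ^{2g}`).
* [Kieffer2024IsogenyGraphs] J. Kieffer, *Isogeny graphs of abelian varieties over finite fields*
  (2024), §1.2.2 p. 22 (`End(A × B) = End A ⊕ Hom(A, B) ⊕ Hom(B, A) ⊕ End B`).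

## Design choices

Theorems only (`Nonempty (_ ≃ₗ[ℤ_[ℓ]] _)` rather than a `def` of the equivalence), so that the
file is a pure-proof proposal; `noncomputable section`, universe-monomorphic `K : Type u` as in
the imported files; products enter as explicit bicone data `(b, hb)` exactly as downstream.
-/

noncomputable section

universe u

open CategoryTheory CategoryTheory.Limits

namespace Literature.AlgebraicGeometry.Motives.AbelianVariety

variable {K : Type u} [Field K] {A A' : AbelianVariety K} (ℓ : ℕ) [Fact ℓ.Prime]

/-! ## `T_ℓ` of a biproduct -/

/-- `T_ℓ inl ∘ T_ℓ fst + T_ℓ inr ∘ T_ℓ snd = 1` on `T_ℓ(b.pt)` for a bicone with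
`fst ≫ inl + snd ≫ inr = 𝟙` (additivity and functoriality of `T_ℓ`, Mumford §19). [folklore] -/
theorem tateModuleMap_bicone_total (b : BinaryBicone A A')
    (hb : b.fst ≫ b.inl + b.snd ≫ b.inr = 𝟙 b.pt) :
    (tateModuleMap ℓ b.inl).comp (tateModuleMap ℓ b.fst) +
        (tateModuleMap ℓ b.inr).comp (tateModuleMap ℓ b.snd) = LinearMap.id := by
  rw [← tateModuleMap_comp, ← tateModuleMap_comp, ← tateModuleMap_add, hb, tateModuleMap_id]

/-- `T_ℓ fst ∘ T_ℓ inl = 1` (from `inl ≫ fst = 𝟙`). [folklore] -/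
theorem tateModuleMap_bicone_inl_fst (b : BinaryBicone A A') :
    (tateModuleMap ℓ b.fst).comp (tateModuleMap ℓ b.inl) = LinearMap.id := by
  rw [← tateModuleMap_comp, b.inl_fst, tateModuleMap_id]

/-- `T_ℓ snd ∘ T_ℓ inl = 0` (from `inl ≫ snd = 0`). [folklore] -/
theorem tateModuleMap_bicone_inl_snd (b : BinaryBicone A A') :
    (tateModuleMap ℓ b.snd).comp (tateModuleMap ℓ b.inl) = 0 := by
  rw [← tateModuleMap_comp, b.inl_snd, tateModuleMap_zero]

/-- `T_ℓ fst ∘ T_ℓ inr = 0` (from `inr ≫ fst = 0`). [folklore] -/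
theorem tateModuleMap_bicone_inr_fst (b : BinaryBicone A A') :
    (tateModuleMap ℓ b.fst).comp (tateModuleMap ℓ b.inr) = 0 := by
  rw [← tateModuleMap_comp, b.inr_fst, tateModuleMap_zero]

/-- `T_ℓ snd ∘ T_ℓ inr = 1` (from `inr ≫ snd = 𝟙`). [folklore] -/
theorem tateModuleMap_bicone_inr_snd (b : BinaryBicone A A') :
    (tateModuleMap ℓ b.snd).comp (tateModuleMap ℓ b.inr) = LinearMap.id := by
  rw [← tateModuleMap_comp, b.inr_snd, tateModuleMap_id]

/-- **The Tate module of a biproduct is the product of the Tate modules.** For a bicone `b` on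
`(A, A')` with `fst ≫ inl + snd ≫ inr = 𝟙`, the map `x ↦ (T_ℓ fst x, T_ℓ snd x)` is a
`ℤ_ℓ`-linear isomorphism `T_ℓ(b.pt) ≅ T_ℓ A × T_ℓ A'`, with inverse
`(a, a') ↦ T_ℓ inl a + T_ℓ inr a'` (`T_ℓ` is an additive functor, Mumford §19, p. 176, so it
carries the biproduct `A ⊞ A'` to the biproduct `T_ℓ A ⊕ T_ℓ A'` of `ℤ_ℓ`-modules).
[cite: MumfordAV1970, §19 p. 176] -/
theorem nonempty_tateModule_linearEquiv_prod (b : BinaryBicone A A')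
    (hb : b.fst ≫ b.inl + b.snd ≫ b.inr = 𝟙 b.pt) :
    Nonempty (b.pt.tateModule ℓ ≃ₗ[ℤ_[ℓ]] A.tateModule ℓ × A'.tateModule ℓ) := by
  refine ⟨LinearEquiv.ofLinear ((tateModuleMap ℓ b.fst).prod (tateModuleMap ℓ b.snd))
    ((tateModuleMap ℓ b.inl).coprod (tateModuleMap ℓ b.inr)) ?_ ?_⟩
  · -- `(T fst, T snd) ∘ (T inl pr₁ + T inr pr₂) = 1`
    have h11 := fun a ↦ LinearMap.congr_fun (tateModuleMap_bicone_inl_fst ℓ b) a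
    have h12 := fun a ↦ LinearMap.congr_fun (tateModuleMap_bicone_inr_fst ℓ b) a
    have h21 := fun a ↦ LinearMap.congr_fun (tateModuleMap_bicone_inl_snd ℓ b) a
    have h22 := fun a ↦ LinearMap.congr_fun (tateModuleMap_bicone_inr_snd ℓ b) a
    simp only [LinearMap.comp_apply, LinearMap.id_apply, LinearMap.zero_apply] at h11 h12 h21 h22
    apply LinearMap.ext
    rintro ⟨a, a'⟩
    simp only [LinearMap.comp_apply, LinearMap.coprod_apply, map_add, LinearMap.id_apply,
      LinearMap.prod_apply, Function.prod, h11, h12, h21, h22, add_zero, zero_add, Prod.mk_add_mk]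
  · -- `(T inl pr₁ + T inr pr₂) ∘ (T fst, T snd) = T (fst ≫ inl + snd ≫ inr) = 1`
    apply LinearMap.ext
    intro x
    have h := LinearMap.congr_fun (tateModuleMap_bicone_total ℓ b hb) x
    simpa only [LinearMap.comp_apply, LinearMap.coprod_apply, LinearMap.prod_apply, Function.prod,
      LinearMap.add_apply, LinearMap.id_apply] using h

/-- **`T_ℓ` of a biproduct is finitely generated if the factors' Tate modules are**: the named
fact `module_finite_tateModule b.pt ℓ` (Mumford §19, p. 171) for the vertex of a bicone with
`fst ≫ inl + snd ≫ inr = 𝟙`, from `module_finite_tateModule A ℓ` and `module_finite_tateModule A' ℓ`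
(transport along `T_ℓ(b.pt) ≅ T_ℓ A × T_ℓ A'`). [cite: MumfordAV1970, §19 p. 171] -/
theorem module_finite_tateModule_pt (b : BinaryBicone A A')
    (hb : b.fst ≫ b.inl + b.snd ≫ b.inr = 𝟙 b.pt)
    (hA : module_finite_tateModule A ℓ) (hA' : module_finite_tateModule A' ℓ) :
    module_finite_tateModule b.pt ℓ := by
  obtain ⟨e⟩ := nonempty_tateModule_linearEquiv_prod ℓ b hb
  haveI : Module.Finite ℤ_[ℓ] (A.tateModule ℓ) := hA
  haveI : Module.Finite ℤ_[ℓ] (A'.tateModule ℓ) := hA'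
  exact Module.Finite.equiv e.symm

/-- **`T_ℓ` of a biproduct is free if the factors' Tate modules are**: the named fact
`module_free_tateModule b.pt ℓ` (`T_ℓ` free over `ℤ_ℓ` for `ℓ ≠ char K`; Mumford §19, p. 171) for
the vertex of a bicone with `fst ≫ inl + snd ≫ inr = 𝟙`, from `module_free_tateModule A ℓ` and
`module_free_tateModule A' ℓ` (transport along `T_ℓ(b.pt) ≅ T_ℓ A × T_ℓ A'`).
[cite: MumfordAV1970, §19 p. 171] -/
theorem module_free_tateModule_pt (b : BinaryBicone A A')
    (hb : b.fst ≫ b.inl + b.snd ≫ b.inr = 𝟙 b.pt)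
    (hA : module_free_tateModule A ℓ) (hA' : module_free_tateModule A' ℓ) :
    module_free_tateModule b.pt ℓ := by
  intro hℓ
  obtain ⟨e⟩ := nonempty_tateModule_linearEquiv_prod ℓ b hb
  haveI : Module.Free ℤ_[ℓ] (A.tateModule ℓ) := hA hℓ
  haveI : Module.Free ℤ_[ℓ] (A'.tateModule ℓ) := hA' hℓ
  exact Module.Free.of_equiv e.symm

end Literature.AlgebraicGeometry.Motives.AbelianVariety
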